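import Mathlib
import Literature.NumberTheory.Transcendental.LindemannWeierstrassProofs

/-!
# Line `sector-split` of crux `RigidCore.SchanuelOnLogFreeCore`, skeleton v13: stub C4
# (conjugate norms over on-axes Lindemann–Weierstrass fields)

Crux `stmt-Schanuel-0970` (`Summit.Schanuel.Schanuel.Theses.RigidCore.SchanuelOnLogFreeCore`, "(R)":
Schanuel's conjecture for `ℚ`-linearly independent tuples from the log-free core), line
`sector-split`, skeleton v13 "conjugate norms".  This file proves the registered CALIBRATION stub
`stub_exp_transcendental_over_onAxesExpField` (stub C4 of the lead's skeleton), signature verbatim.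

## The device

Complex conjugation acts on VALUES: for an intermediate field `F ≤ ℂ` that is stable under
conjugation, `e^u ∈ F^alg ⟹ e^{ū} = conj (e^u) ∈ F^alg ⟹ e^{u − ū} = e^{2i·Im u} ∈ F^alg` and
`e^{u + ū} = e^{2 Re u} ∈ F^alg`.  Here it is applied to the ON-AXES Lindemann–Weierstrass field
`F = ℚ(e^{a_1}, …, e^{a_d})` of a `ℚ`-linearly independent algebraic tuple `a` whose entries are
real or purely imaginary: then `conj a_j = ± a_j`, so `conj (e^{a_j}) = e^{conj a_j}` is `e^{a_j}` or
`(e^{a_j})⁻¹`, both in `F`, and `F` is conj-stable (`OnAxesExpField.conj_mem_adjoin_exp`).  If now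
`i·Im u` is algebraic and outside `span_ℚ(a)` (resp. `Re u` algebraic and outside `span_ℚ(a)`), the
`d + 1` numbers `(a, 2i·Im u)` (resp. `(a, 2 Re u)`) are algebraic and `ℚ`-linearly independent, so
by Lindemann–Weierstrass (tree theorem
`Literature.NumberTheory.Transcendental.algebraicIndependent_exp_holds`, PROVED; A. Baker,
*Transcendental Number Theory* (1975), Ch. 1 Thm 1.4 and the remark following it) their
exponentials are algebraically independent, i.e. `e^{2i·Im u}` (resp. `e^{2 Re u}`) is
TRANSCENDENTAL over `F` (`OnAxesExpField.exp_transcendental_of_not_mem_span`) — so `e^u ∉ F^alg`.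

## Main statements (namespace `Summit.Schanuel.Schanuel.Theorems.RigidCore`)

* `stub_exp_transcendental_over_onAxesExpField` — the registered stub: `e^u` is transcendental
  over `ℚ(e^{a})`;
* `OnAxesExpField.algebraicIndependent_exp_cons` — hence `(e^u, e^{a})` is algebraically
  independent over `ℚ`;
* `OnAxesExpField.schanuelCount_cons` — Schanuel's lower bound at the tuple `(u, a)` already from
  the exponentials: `d + 1 ≤ trdeg_ℚ ℚ(e^u, e^{a})`.

Cells: `e^{e+i} ∉ ℚ(e)^alg` (`a = (1)`, `u = e + i`); `e^{π+i}` is transcendental (`d = 0`,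
`u = π + i`); `e^{1 + e·i} ∉ ℚ(e^{i})^alg` (`a = (i)`, `u = 1 + e·i`).

Helpers live in the sub-namespace `OnAxesExpField` (conj-stability of `ℚ(e^{a})`, conjugation of
algebraic elements over a conj-stable field, the Lindemann–Weierstrass transcendence step, the
identities `u ∓ ū = 2i·Im u, 2 Re u`).  No new definitions.

NOT here: the two residues of the line (`stub_piFreeOnAxes`, `stub_coreRelSchanuelOverPiLWField` —
open-problem strength) and the `π`-anchored cells of the device (stubs C2/C3 of the skeleton, via
Nesterenko), which live in the lead's files.

## References

* [BakerTNT1975] A. Baker, *Transcendental Number Theory*, Cambridge University Press (1975),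
  Ch. 1 §3, Theorem 1.4 and the remark following it (Lindemann–Weierstrass), p. 6.
-/

-- `Summit.Schanuel.Schanuel.…` is the D-0017 single-problem layout
set_option linter.dupNamespace false

noncomputable section

namespace Summit.Schanuel.Schanuel.Theorems.RigidCore

open IntermediateField
open Literature.NumberTheory.Transcendental

namespace OnAxesExpField

/-! ## Conj-stability of the on-axes Lindemann–Weierstrass field `ℚ(e^{a})` -/

/-- For `a_i` real or purely imaginary, `conj (e^{a_i}) = e^{conj a_i} ∈ {e^{a_i}, (e^{a_i})⁻¹}`
lies in `ℚ(e^{a})`. [folklore] -/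
theorem conj_exp_mem_adjoin_exp {d : ℕ} {a : Fin d → ℂ} (hax : ∀ i, (a i).im = 0 ∨ (a i).re = 0)
    (i : Fin d) :
    (starRingEnd ℂ) (Complex.exp (a i)) ∈ adjoin ℚ (Set.range (Complex.exp ∘ a)) := by
  have hmem : Complex.exp (a i) ∈ adjoin ℚ (Set.range (Complex.exp ∘ a)) :=
    subset_adjoin ℚ _ ⟨i, rfl⟩
  rw [← Complex.exp_conj]
  rcases hax i with h | h
  · rwa [Complex.conj_eq_iff_im.2 h]
  · have e : (starRingEnd ℂ) (a i) = -a i := Complex.ext (by simp [h]) (by simp)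
    rw [e, Complex.exp_neg]
    exact inv_mem hmem

/-- The on-axes Lindemann–Weierstrass field `ℚ(e^{a})` (`a_i` real or purely imaginary) is stable
under complex conjugation. [folklore] -/
theorem conj_mem_adjoin_exp {d : ℕ} {a : Fin d → ℂ} (hax : ∀ i, (a i).im = 0 ∨ (a i).re = 0) :
    ∀ z ∈ adjoin ℚ (Set.range (Complex.exp ∘ a)),
      (starRingEnd ℂ) z ∈ adjoin ℚ (Set.range (Complex.exp ∘ a)) := by
  intro z hz
  induction hz using IntermediateField.adjoin_induction with
  | mem x hx =>
    obtain ⟨i, rfl⟩ := hx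
    exact conj_exp_mem_adjoin_exp hax i
  | algebraMap q =>
    have e : (starRingEnd ℂ) (algebraMap ℚ ℂ q) = algebraMap ℚ ℂ q := by simp
    rw [e]
    exact IntermediateField.algebraMap_mem _ q
  | add x y _ _ hx hy =>
    rw [map_add]
    exact add_mem hx hy
  | inv x _ hx =>
    rw [map_inv₀]
    exact inv_mem hx
  | mul x y _ _ hx hy =>
    rw [map_mul]
    exact mul_mem hx hy

/-! ## Conjugation of algebraic elements over a conj-stable field -/

/-- If `F ≤ ℂ` is conj-stable and `x` is algebraic over `F`, then so is `conj x` (conjugation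
restricts to a ring endomorphism of `F`; map the annihilating polynomial). [folklore] -/
theorem isAlgebraic_conj_of_conj_mem (F : IntermediateField ℚ ℂ)
    (hF : ∀ z ∈ F, (starRingEnd ℂ) z ∈ F) {x : ℂ} (hx : IsAlgebraic F x) :
    IsAlgebraic F ((starRingEnd ℂ) x) := by
  let σ : ℂ →ₐ[ℚ] ℂ := (starRingEnd ℂ).toRatAlgHom
  have h1 : IsAlgebraic (F.map σ) (σ x) :=
    hx.ringHom_of_comp_eq (F.equivMap σ : F →+* F.map σ) (σ : ℂ →+* ℂ)
      (F.equivMap σ).injective (by ext; rfl)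
  have hle : F.map σ ≤ F := by
    rintro _ ⟨z, hz, rfl⟩
    exact hF z hz
  exact h1.ringHom_of_comp_eq (IntermediateField.inclusion hle : F.map σ →+* F) (RingHom.id ℂ)
    (IntermediateField.inclusion hle).injective (by ext; rfl)

/-! ## The Lindemann–Weierstrass step -/

/-- **Lindemann–Weierstrass step.** For `a` algebraic and `ℚ`-linearly independent and `v`
algebraic with `v ∉ span_ℚ(a)`, the tuple `(v, a)` is `ℚ`-free and algebraic, so
`(e^v, e^{a})` is algebraically independent over `ℚ` (tree theorem
`algebraicIndependent_exp_holds`), i.e. `e^v` is transcendental over `ℚ(e^{a})`.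
[cite: BakerTNT1975, Ch. 1 Thm 1.4] -/
theorem exp_transcendental_of_not_mem_span {d : ℕ} {a : Fin d → ℂ}
    (ha : ∀ i, IsAlgebraic ℚ (a i)) (hli : LinearIndependent ℚ a) {v : ℂ}
    (hv : IsAlgebraic ℚ v) (hvs : v ∉ Submodule.span ℚ (Set.range a)) :
    Transcendental (adjoin ℚ (Set.range (Complex.exp ∘ a))) (Complex.exp v) := by
  have halg : ∀ o : Option (Fin d), IsAlgebraic ℚ (o.elim v a) := by
    rintro (_ | i)
    exacts [hv, ha i]
  have hli' : LinearIndependent ℚ (fun o : Option (Fin d) => o.elim v a) :=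
    linearIndependent_option.2 ⟨hli, hvs⟩
  have hLW : AlgebraicIndependent ℚ
      (fun o : Option (Fin d) => o.elim (Complex.exp v) (Complex.exp ∘ a)) := by
    convert algebraicIndependent_exp_holds _ halg hli' using 1
    funext o
    cases o <;> rfl
  exact IntermediateField.transcendental_adjoin_iff.2 (AlgebraicIndependent.option_iff.1 hLW).2

/-! ## The identities `u - ū = 2i·Im u`, `u + ū = 2 Re u` -/

/-- `2 • (i·Im u) = u - ū`. [folklore] -/
theorem two_smul_im_mul_I (u : ℂ) :
    (2 : ℚ) • ((u.im : ℂ) * Complex.I) = u - (starRingEnd ℂ) u := by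
  rw [Rat.smul_def, Rat.cast_ofNat]
  apply Complex.ext <;> simp [two_mul]

/-- `2 • Re u = u + ū`. [folklore] -/
theorem two_smul_re (u : ℂ) : (2 : ℚ) • (u.re : ℂ) = u + (starRingEnd ℂ) u := by
  rw [Rat.smul_def, Rat.cast_ofNat]
  apply Complex.ext <;> simp [two_mul]

end OnAxesExpField

open OnAxesExpField

/-! ## The registered stub -/

/-- **Stub `stub_exp_transcendental_over_onAxesExpField` of line `sector-split` (skeleton v13,
calibration C4), registered signature: exponentials of points with an algebraic coordinate are
transcendental over on-axes Lindemann–Weierstrass fields.**  For `a : Fin d → ℂ` algebraic,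
`ℚ`-linearly independent, each entry real or purely imaginary (so `F = ℚ(e^{a})` is conj-stable),
and `u : ℂ` with `i·Im u` algebraic and not in `span_ℚ(a)` (resp. `Re u` algebraic and not in
`span_ℚ(a)`), `e^u` is transcendental over `F`: otherwise `e^{ū} = conj (e^u)` is algebraic over
`F` too, hence so is `e^{2i Im u} = e^u (e^{ū})⁻¹` (resp. `e^{2 Re u} = e^u e^{ū}`), against
Lindemann–Weierstrass for the `ℚ`-free algebraic tuple `(2i Im u, a)` (resp. `(2 Re u, a)`).
[cite: BakerTNT1975, Ch. 1 Thm 1.4] -/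
theorem stub_exp_transcendental_over_onAxesExpField :
    ∀ (d : ℕ) (a : Fin d → ℂ) (u : ℂ), (∀ i, IsAlgebraic ℚ (a i)) →
      (∀ i, (a i).im = 0 ∨ (a i).re = 0) → LinearIndependent ℚ a →
      ((IsAlgebraic ℚ ((u.im : ℂ) * Complex.I) ∧ (u.im : ℂ) * Complex.I ∉ Submodule.span ℚ (Set.range a)) ∨
        (IsAlgebraic ℚ (u.re : ℂ) ∧ (u.re : ℂ) ∉ Submodule.span ℚ (Set.range a))) →
      Transcendental ↥(IntermediateField.adjoin ℚ (Set.range (Complex.exp ∘ a))) (Complex.exp u) := by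
  intro d a u ha hax hli hu halg
  -- the device: `e^{ū} = conj (e^u)` is algebraic over the conj-stable field `ℚ(e^{a})`
  have hconj : IsAlgebraic (adjoin ℚ (Set.range (Complex.exp ∘ a)))
      (Complex.exp ((starRingEnd ℂ) u)) := by
    rw [Complex.exp_conj]
    exact isAlgebraic_conj_of_conj_mem _ (conj_mem_adjoin_exp hax) halg
  rcases hu with ⟨hv, hvs⟩ | ⟨hv, hvs⟩
  · -- imaginary axis: `e^{2i Im u} = e^u (e^{ū})⁻¹` is algebraic over `ℚ(e^{a})`, against LW
    refine exp_transcendental_of_not_mem_span ha hli (hv.smul (2 : ℚ))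
      (fun h => hvs ((Submodule.smul_mem_iff _ two_ne_zero).1 h)) ?_
    rw [two_smul_im_mul_I, Complex.exp_sub, div_eq_mul_inv]
    exact halg.mul hconj.inv
  · -- real axis: `e^{2 Re u} = e^u e^{ū}` is algebraic over `ℚ(e^{a})`, against LW
    refine exp_transcendental_of_not_mem_span ha hli (hv.smul (2 : ℚ))
      (fun h => hvs ((Submodule.smul_mem_iff _ two_ne_zero).1 h)) ?_
    rw [two_smul_re, Complex.exp_add]
    exact halg.mul hconj

/-! ## Schanuel's count at `(u, a)` from the exponentials alone -/

namespace OnAxesExpField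

/-- **`(e^u, e^{a})` is algebraically independent** under the hypotheses of the stub: `e^{a}` is
algebraically independent by Lindemann–Weierstrass and `e^u` is transcendental over `ℚ(e^{a})`
(`AlgebraicIndependent.option_iff`, reindexed along `Fin (d + 1) ≃ Option (Fin d)`).
[cite: BakerTNT1975, Ch. 1 Thm 1.4] -/
theorem algebraicIndependent_exp_cons {d : ℕ} {a : Fin d → ℂ} {u : ℂ}
    (ha : ∀ i, IsAlgebraic ℚ (a i)) (hax : ∀ i, (a i).im = 0 ∨ (a i).re = 0)
    (hli : LinearIndependent ℚ a)
    (hu : (IsAlgebraic ℚ ((u.im : ℂ) * Complex.I) ∧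
        (u.im : ℂ) * Complex.I ∉ Submodule.span ℚ (Set.range a)) ∨
      (IsAlgebraic ℚ (u.re : ℂ) ∧ (u.re : ℂ) ∉ Submodule.span ℚ (Set.range a))) :
    AlgebraicIndependent ℚ (Complex.exp ∘ (Fin.cons u a : Fin (d + 1) → ℂ)) := by
  have hT := stub_exp_transcendental_over_onAxesExpField d a u ha hax hli hu
  have hLW : AlgebraicIndependent ℚ (Complex.exp ∘ a) := algebraicIndependent_exp_holds a ha hli
  have hopt : AlgebraicIndependent ℚ
      (fun o : Option (Fin d) => o.elim (Complex.exp u) (Complex.exp ∘ a)) :=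
    AlgebraicIndependent.option_iff.2 ⟨hLW, IntermediateField.transcendental_adjoin_iff.1 hT⟩
  have e : Complex.exp ∘ (Fin.cons u a : Fin (d + 1) → ℂ) =
      (fun o : Option (Fin d) => o.elim (Complex.exp u) (Complex.exp ∘ a)) ∘ finSuccEquiv d := by
    funext i
    cases i using Fin.cases with
    | zero => simp
    | succ j => simp
  rw [e, algebraicIndependent_equiv]
  exact hopt

/-- **Schanuel's count at the tuple `(u, a)`, already from the exponentials**: under the
hypotheses of the stub, `d + 1 ≤ trdeg_ℚ ℚ(e^u, e^{a})` (the `d + 1` generators are algebraically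
independent), hence a fortiori `d + 1 ≤ trdeg_ℚ ℚ(u, a, e^u, e^{a})` — Schanuel's conjecture holds
at `(u, a)` whenever that tuple is `ℚ`-linearly independent. [cite: BakerTNT1975, Ch. 1 Thm 1.4] -/
theorem schanuelCount_cons {d : ℕ} {a : Fin d → ℂ} {u : ℂ}
    (ha : ∀ i, IsAlgebraic ℚ (a i)) (hax : ∀ i, (a i).im = 0 ∨ (a i).re = 0)
    (hli : LinearIndependent ℚ a)
    (hu : (IsAlgebraic ℚ ((u.im : ℂ) * Complex.I) ∧
        (u.im : ℂ) * Complex.I ∉ Submodule.span ℚ (Set.range a)) ∨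
      (IsAlgebraic ℚ (u.re : ℂ) ∧ (u.re : ℂ) ∉ Submodule.span ℚ (Set.range a))) :
    ((d + 1 : ℕ) : Cardinal) ≤ Algebra.trdeg ℚ
      ↥(IntermediateField.adjoin ℚ (Set.range (Complex.exp ∘ (Fin.cons u a : Fin (d + 1) → ℂ)))) := by
  set L := IntermediateField.adjoin ℚ (Set.range (Complex.exp ∘ (Fin.cons u a : Fin (d + 1) → ℂ)))
  let y : Fin (d + 1) → L :=
    fun i => ⟨(Complex.exp ∘ (Fin.cons u a : Fin (d + 1) → ℂ)) i, subset_adjoin ℚ _ ⟨i, rfl⟩⟩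
  have hy : AlgebraicIndependent ℚ y :=
    AlgebraicIndependent.of_comp L.val (by exact algebraicIndependent_exp_cons ha hax hli hu)
  simpa using hy.cardinalMk_le_trdeg

end OnAxesExpField

end Summit.Schanuel.Schanuel.Theorems.RigidCore

end
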